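import Mathlib
import HarnessLib
import Summits.Langlands.Langlands.Theorems.EisensteinGelfandKirillovProModularOfGKBoundDefs
import Summits.Langlands.Langlands.Theorems.ReducibleOrdinaryProModular.Negative.LevelAndRamification

/-!
# Stub `stub_readout` (line `eisenstein-fern`, crux `ProModularOfGKBound`, stmt-Langlands-18273)

The READOUT step of the Eisenstein infinite fern: a rank-two `ρ : Γ_F → GL₂(ℚ̄_p)` unramified
outside `𝒰.bad` which lies on a Zariski-dense Hecke family of tame level `𝒰`
(`DenseHeckeFamily 𝒰 ρ`, vocabulary file `EisensteinGelfandKirillovProModularOfGKBoundDefs`) is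
`p`-adically automorphic of level `𝒰` (`TameLevel.IsPadicallyAutomorphic`).

Proof (Mathlib topology/algebra only).  Let `A` be the compact Hausdorff domain of the family,
`pt k : A → ℚ̄_p` its dense family of continuous points and `h k : 𝕋(𝒰) → ℚ̄_p` the continuous
Hecke eigensystems they carry.

* `e = (pt k)_k : A → ∏_k ℚ̄_p` is a continuous injective (density) ring map from a compact space to
  a Hausdorff space, hence a closed embedding (`Continuous.isClosedEmbedding`);
* `ψ = (h k)_k : 𝕋(𝒰) → ∏_k ℚ̄_p` is a continuous ring map, and the closed subring
  `ψ⁻¹(e(A)) ⊆ 𝕋(𝒰)` contains every topological generator `T_{v,i}`, `S_v⁻¹` of `𝕋(𝒰)`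
  (`ψ(T_{v,i}) = e(a v i)`, `ψ(S_v⁻¹) = e(b v)`), hence is everything
  (`Subring.topologicalClosure_minimal`, `𝕋(𝒰)` being by definition the closure of the subring
  generated by `𝒰.heckeGenerators` in the product of the discrete finite-level endomorphism rings);
* so `ψ = e ∘ φ` for a ring map `φ : 𝕋(𝒰) → A`, continuous because `e` is an embedding, with
  `φ(T_{v,i}) = a v i`;
* the point `x ∘ φ : 𝕋(𝒰) → ℚ̄_p` is continuous and, at an arithmetic Frobenius `σ` at `v ∉ 𝒰.bad`,
  `charpoly ρ(σ) = X² − tr ρ(σ) X + det ρ(σ)` (`Matrix.charpoly_fin_two`)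
  `= X² − x(a v 1) X + q_v x(a v 2) = heckeFrobPoly 2 q_v (x ∘ φ ∘ T_{v,·})` (`heckeFrobPoly_two`).
-/

set_option linter.dupNamespace false
set_option autoImplicit false

noncomputable section

open scoped NumberField Polynomial
open IsDedekindDomain Filter Topology
open Literature.NumberTheory.GaloisRepresentations Literature.NumberTheory.Automorphic
open Literature.NumberTheory.Automorphic.BigHeckeGLn
open Summit.Langlands.Langlands.Theorems.ReducibleOrdinaryProModular.Negative

namespace Summit.Langlands.Langlands.Cruxes.ProModularOfGKBound.EisensteinFern

variable {F : Type} [Field F] [NumberField F] {p : ℕ} [Fact p.Prime]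

/-- **A closed subring of `𝕋(𝒰)` containing the topological generators is everything.**  If a closed
subring `M ⊆ 𝕋(𝒰)` contains every `T_{v,i}` and every `S_v⁻¹` (`v ∉ 𝒰.bad`), then `M = 𝕋(𝒰)`:
its image in the ambient product of discrete rings is closed (`𝕋(𝒰)` is closed there) and contains
`𝒰.heckeGenerators`, hence contains the closure of the subring they generate, which is `𝕋(𝒰)` by
definition. [folklore] -/
private theorem eq_top_of_isClosed_of_generators_mem (𝒰 : TameLevel 2 F p)
    (M : Subring (CompletedCohomologyHeckeAlgebraGLn 𝒰))
    (hM : IsClosed (M : Set (CompletedCohomologyHeckeAlgebraGLn 𝒰)))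
    (hT : ∀ v : Pl F, v ∉ 𝒰.bad → ∀ i : ℕ, 𝒰.heckeT v i ∈ M)
    (hS : ∀ (v : Pl F) (hv : v ∉ 𝒰.bad), heckeSinv 𝒰 v hv ∈ M) : M = ⊤ := by
  refine eq_top_iff.2 fun t _ => ?_
  -- the generators lie in the image `M'` of `M` in the ambient product ring
  have hgen : 𝒰.heckeGenerators ⊆ (M.map 𝒰.bigHeckeSubring.subtype : Set 𝒰.bigEnd) := by
    rintro T (⟨v, hv, i, rfl⟩ | ⟨v, hv, rfl⟩)
    · exact Subring.mem_map.2 ⟨𝒰.heckeT v i, hT v hv i, 𝒰.coe_heckeT hv i⟩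
    · exact Subring.mem_map.2 ⟨heckeSinv 𝒰 v hv, hS v hv, coe_heckeSinv 𝒰 v hv⟩
  -- `M'` is closed: `M` is closed in the closed subspace `𝕋(𝒰)` of the product
  have hclT : IsClosed ((𝒰.bigHeckeSubring : Subring 𝒰.bigEnd) : Set 𝒰.bigEnd) :=
    Subring.isClosed_topologicalClosure _
  have hM' : IsClosed (M.map 𝒰.bigHeckeSubring.subtype : Set 𝒰.bigEnd) := by
    rw [Subring.coe_map]
    exact hclT.isClosedEmbedding_subtypeVal.isClosedMap _ hM
  -- hence `𝕋(𝒰) = closure ⟨generators⟩ ≤ M'`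
  have hle : 𝒰.bigHeckeSubring ≤ M.map 𝒰.bigHeckeSubring.subtype :=
    Subring.topologicalClosure_minimal _ (Subring.closure_le.2 hgen) hM'
  obtain ⟨m, hm, hmt⟩ := Subring.mem_map.1 (hle t.2)
  rw [← Subtype.ext hmt]
  exact hm

/-- **Continuous factorisation through a closed embedding of rings.**  If `e : A → P` is a ring map
that is a closed embedding and `ψ : T → P` is a continuous ring map with values in the range of `e`,
then `ψ = e ∘ φ` for a continuous ring map `φ : T → A`. [folklore] -/
private theorem exists_ringHom_comp_eq {T A P : Type*} [Ring T] [Ring A] [Ring P]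
    [TopologicalSpace T] [TopologicalSpace A] [TopologicalSpace P]
    (ψ : T →+* P) (e : A →+* P) (hψ : Continuous ψ) (he : IsClosedEmbedding e)
    (hrange : ∀ t, ψ t ∈ Set.range e) :
    ∃ φ : T →+* A, Continuous φ ∧ ∀ t, e (φ t) = ψ t := by
  choose f hf using hrange
  have hinj : Function.Injective e := he.injective
  have hcomp : (e ∘ f : T → P) = ψ := funext hf
  refine ⟨{ toFun := f
            map_one' := hinj (by rw [hf, map_one, map_one])
            map_mul' := fun s t => hinj (by rw [hf, map_mul, map_mul, hf, hf])
            map_zero' := hinj (by rw [hf, map_zero, map_zero])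
            map_add' := fun s t => hinj (by rw [hf, map_add, map_add, hf, hf]) }, ?_, hf⟩
  show Continuous f
  rw [he.isEmbedding.continuous_iff, hcomp]
  exact hψ

/-- **Stub 4 — THE READOUT.**  A `ρ : Γ_F → GL₂(ℚ̄_p)` unramified outside `𝒰.bad` lying on a
Zariski-dense Hecke family of level `𝒰` is `p`-adically automorphic of level `𝒰`: with
`e = (pt k)_k : A ↪ ∏_k ℚ̄_p` (a closed embedding, `A` compact) and `ψ = (h k)_k : 𝕋(𝒰) → ∏_k ℚ̄_p`,
the closed subring `ψ⁻¹(e(A))` contains all generators of `𝕋(𝒰)`, so `ψ = e ∘ φ` with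
`φ : 𝕋(𝒰) → A` a continuous ring map, `φ(T_{v,i}) = a v i`; the point `x ∘ φ` is associated with `ρ`
by `charpoly ρ(σ) = X² − tr·X + det` (`Matrix.charpoly_fin_two`, `heckeFrobPoly_two`). [folklore] -/
theorem stub_readout :
    ∀ (F : Type) [Field F] [NumberField F] (p : ℕ) [Fact p.Prime]
      (𝒰 : TameLevel 2 F p) (ρ : FramedGaloisRep F (PadicAlgCl p) 2),
      (∀ v ∉ 𝒰.bad, ρ.IsUnramifiedAt v) → DenseHeckeFamily 𝒰 ρ → 𝒰.IsPadicallyAutomorphic ρ := by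
  intro F _ _ p _ 𝒰 ρ hur hfam
  obtain ⟨A, _, _, _, _, _, _, a, b, x, κ, pt, hx, hpt, hdense, hxρ, hh⟩ := hfam
  choose h hhc hhT hhS using hh
  -- the closed embedding `e : A ↪ ∏_k ℚ̄_p` and the continuous `ψ : 𝕋(𝒰) → ∏_k ℚ̄_p`
  set e : A →+* (κ → PadicAlgCl p) := RingHom.pi pt
  set ψ : CompletedCohomologyHeckeAlgebraGLn 𝒰 →+* (κ → PadicAlgCl p) := RingHom.pi h
  have hec : Continuous e := continuous_pi fun k => hpt k
  have hψc : Continuous ψ := continuous_pi fun k => hhc k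
  have heinj : Function.Injective e :=
    (injective_iff_map_eq_zero e).2 fun z hz => hdense z fun k => congrFun hz k
  have he : IsClosedEmbedding e := hec.isClosedEmbedding heinj
  -- every value of `ψ` lies in the (closed) range of `e`
  have hrange : ∀ t, ψ t ∈ Set.range e := by
    have htop : (e.range).comap ψ = ⊤ := by
      refine eq_top_of_isClosed_of_generators_mem 𝒰 _ ?_ ?_ ?_
      · rw [Subring.coe_comap, RingHom.coe_range]
        exact he.isClosed_range.preimage hψc
      · intro v hv i
        exact ⟨a v i, funext fun k => (hhT k v hv i).symm⟩
      · intro v hv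
        exact ⟨b v, funext fun k => (hhS k v hv).symm⟩
    intro t
    have ht : t ∈ (e.range).comap ψ := htop ▸ Subring.mem_top t
    exact ht
  -- factor `ψ = e ∘ φ`, `φ : 𝕋(𝒰) → A` continuous, `φ (T_{v,i}) = a v i`
  obtain ⟨φ, hφc, hφ⟩ := exists_ringHom_comp_eq ψ e hψc he hrange
  have hφT : ∀ v : Pl F, v ∉ 𝒰.bad → ∀ i : ℕ, φ (𝒰.heckeT v i) = a v i := fun v hv i =>
    heinj ((hφ _).trans (funext fun k => hhT k v hv i))
  -- the point `x ∘ φ` is associated with `ρ`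
  rw [isPadicallyAutomorphic_iff]
  refine ⟨x.comp φ, hx.comp hφc, fun v hv => ⟨hur v hv, fun 𝔓 h𝔓 σ hσ => ?_⟩⟩
  obtain ⟨htr, hdet⟩ := hxρ v hv 𝔓 h𝔓 σ hσ
  simp only [heckeFrobPoly_two, RingHom.comp_apply, hφT v hv]
  rw [htr, hdet]
  exact Matrix.charpoly_fin_two _

end Summit.Langlands.Langlands.Cruxes.ProModularOfGKBound.EisensteinFern

end
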